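import Literature.NumberTheory.EllipticCurves.Kato2004.DivisibilityInputsFine
import HarnessLib

/-!
# The carrier «Euler loss `δ = 0`» of a pair `(E, p)`: every §17.13 Kato package has a zeta module
# `Z ⊂ 𝐇¹` with `μ(𝐇¹/Z) = 0` — one predicate with a body, nothing else

Topic `NumberTheory/EllipticCurves/Rank1Residual` (namespace = path; companion of `MuLambdaCarriers.lean`
§3 `KatoDivisibilityAt` and of `MuLeFineMuCarrier.lean` `MuLeFineMuAt`).  Cell `bsd-f3-mu` (D-0131 (3)),
typer seat; transcription of the `-es` lens's generation-6 carrier (MEMO-es §27,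
`HOME/es/EulerLossChartExact.lean` = «Sketch7», sha16 4b5b6c8384c6f496, rc 0, 0 sorry; refuter `-ref1`:
SURVIVES (self-BC7 2/2 CLEAN, `es/bc7_verdicts7.txt` f2b96bbbfd84871b); refuter `-ref2` row es-§27
(REF2-LITMAP): OPEN as a class-wide statement on X9, not in print, implied by `μ^an = 0`).  ONE
predicate with a body; nothing is asserted about any pair; no named fact, no theorem.  The class-wide
statement on X9 (cell candidate ES-C7) is an obligation node Summits-side (`SmallImageMu/EulerLossZero.lean`);
its kernel edges (`μ^an = 0 ⟹ δ = 0` per pair with no further input; `μ^an = 0 ⟺ (δ = 0 ∧ e = 0)`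
modulo F1; ES-C7 ⟹ ES-C2) are `SmallImageMu/EulerLossZeroEdges.lean`; the generic `μ`-bookkeeping they
use is `IwasawaAlgebraMuQuotientProofs.lean`.

THE CHART (Kato §17.13, pp. 279–280; cell MEMO-es §9).  For a §17.13 package
`K : Kato2004.DivisibilityInputs W p f κ γ I D` (Thm. 12.4–12.6, Prop. 17.11: `𝐇¹ ↪ P ↪ Λ`,
`P → X(E/ℚ_∞) → 𝐇² → 𝐇²_loc`, the zeta module `Z ⊂ 𝐇¹` of Thm. 12.6 with `p^n · L_p(E,T) ∈ col(loc Z)`)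
the analytic `μ` splits along `z ↦ loc_p z ↦ Col(loc_p z) = L_p` as `μ(L_p) = δ + e + c` with
`δ = μ(𝐇¹/Z)` — the EULER LOSS of the package: the power of `p` by which the integral zeta elements
fail to generate `𝐇¹` at the prime `(p)` —, `e = μ(P/loc 𝐇¹)`, `c = μ(Λ/col P) = 0` (Prop. 17.11); the
exact identities `μ(X) + δ = μ(Λ/(G₁)) + μ(X₀)` and `k + δ = μ(X₀)` are tree theorems
(`SmallImageMu.mu_add_eulerLoss_eq`, `SmallImageMu.muDefect_add_eulerLoss_eq`, over
`Kim2025.lengthAt_add_lengthAt_quotient_zeta_eq_heightOne`).  IN PRINT `δ` is controlled when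
`ρ_{E,p^∞}` is onto `GL₂(ℤ_p)` (Thm. 12.5 (4) under hypothesis (12.5.2): `Z(f,T) ⊂ 𝐇¹(T)` and the
`𝔭`-length bound at EVERY height-one prime; Thm. 13.4 (3)); without (12.5.2) only «`Z(f,T)/Z` is a
finite group» (Thm. 12.6) and the bound at the primes `𝔭 ∌ p` (Thm. 12.5 (3), Thm. 13.4 (2)) are
printed — at non-surjective image the Euler-system argument gives `char(Y) ∣ pᵗ · ind(c_∞)` «for some
integer `t ≥ 0`» (Wuthrich, p. 715, quoting Rubin's Thm. 2.3.4).  The `μ`-part `δ` is the ES-lens reading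
of the cell's search question «what power of `p` is lost at non-surjective image».

* `EulerLossZeroAt W p` — for all cyclotomic data `(κ, γ)`, every newform `f` of `W`, every `𝐇¹`-datum
  `I`, every dual Selmer datum `D` and EVERY package `K` over them: `μ(I.H ⧸ K.Z) = 0` (verbatim the
  audited Sketch7 §3 text; the PACKAGE form of the tree node `SmallImageMu.EulerPrimitiveOnClassX9`
  «some genuine Euler-system class `∉ p𝐇¹`», which it implies through the Thm. 12.6 span clause and
  `𝐇¹ ≅ Λ` — edge (c7c) of `SmallImageMu/EulerLossZeroEdges.lean`).

References: K. Kato, Astérisque 295 (2004), Thm. 12.4 (p. 221), Thm. 12.5 (pp. 221–222), Thm. 12.6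
(p. 222), Thm. 13.4 (p. 226), Prop. 17.11 (p. 277), §17.13 (pp. 279–280) [Kato2004Asterisque];
C. Wuthrich, Math. Res. Lett. 13 (2006), Thm. 2 (p. 715), Lemma 3 (p. 716), Prop. 7 (p. 717)
[Wuthrich2006]; HOME MEMO-es.md §9, §27, es/EulerLossChartExact.lean, REF2-LITMAP.md row es-§27,
CANDIDATES.md §1 row 26.
-/

noncomputable section

open scoped Classical MatrixGroups ModularForm
open CongruenceSubgroup WeierstrassCurve Field
open Literature.NumberTheory.GaloisRepresentations
open Literature.NumberTheory.EllipticCurves Literature.NumberTheory.EllipticCurves.ModularForms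
open Literature.NumberTheory.EllipticCurves.Kato2004
open Literature.NumberTheory.EllipticCurves.Kato2004.EulerSystemValues
open IwasawaAlgebra

namespace Literature.NumberTheory.EllipticCurves.Rank1Residual

/-- **`EulerLossZeroAt W p` — «`δ = 0` for every package»: every §17.13 Kato package over the pair is
Euler-PRIMITIVE at `(p)`** (a PREDICATE on pairs; nothing asserted).  For all cyclotomic data `(κ, γ)`,
every newform `f` of `W` (any level), every `𝐇¹`-datum `I : Kato2004.IwasawaH1Data W p κ γ`, every dual
Selmer datum `D` of `Sel(ℚ_∞, E[p^∞])` and EVERY package `K : Kato2004.DivisibilityInputs W p f κ γ I D`: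
`μ(I.H ⧸ K.Z) = 0`, i.e. the zeta module `Z ⊂ 𝐇¹` of Thm. 12.6 generates `𝐇¹` up to a module of
`μ`-invariant zero.  Printed at surjective image (Thm. 12.5 (4) under (12.5.2), Thm. 13.4 (3)); at
non-surjective image only «`Z(f,T)/Z` is a finite group» (Thm. 12.6) and the bound at the primes `𝔭 ∌ p`
(Thm. 12.5 (3)) are printed, the `(p)`-part being the unspecified `t ≥ 0` of `char(Y) ∣ pᵗ · ind(c_∞)`
(Wuthrich p. 715).  Verbatim the audited `HOME/es/EulerLossChartExact.lean` §3.
[cite: Kato2004Asterisque, Thm. 12.5 (3)–(4) (pp. 221–222), Thm. 12.6 (p. 222), Thm. 13.4 (p. 226), §17.13 (pp. 279–280) — shape; transcribed as a predicate, the surjective-image case is what is printed]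
[cite: Wuthrich2006, Thm. 2 (p. 715: `char Y ∣ pᵗ · ind(c_∞)` for some `t ≥ 0` via Rubin's Thm. 2.3.4; `t` unspecified off surjectivity)] -/
def EulerLossZeroAt (W : WeierstrassCurve ℚ) [W.IsElliptic] [W.IsGloballyMinimal] (p : ℕ) [Fact p.Prime]
    [ContinuousSMul ℤ_[p] (W.tateModule p)] : Prop :=
  ∀ (κ : ZpExtension ℚ p) (γ : Field.absoluteGaloisGroup ℚ) {N : ℕ} [NeZero N]
    (f : CuspForm (Gamma0 N) 2),
    κ.IsCyclotomic → κ.IsTopGenerator γ → IsCyclotomicVariable p γ → IsNewformOf W f →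
    ∀ (I : IwasawaH1Data W p κ γ) (D : W.SelmerDualData κ γ) (K : DivisibilityInputs W p f κ γ I D),
      muInvariant p (I.H ⧸ K.Z) = 0

end Literature.NumberTheory.EllipticCurves.Rank1Residual

end
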